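import Literature.NumberTheory.EllipticCurves.MordellCurveSwanConductorProofs
import Literature.NumberTheory.EllipticCurves.MordellCurveTateAlgorithmTwoProofs
import Literature.NumberTheory.EllipticCurves.SwanConductorVariableChangeProofs
import Literature.NumberTheory.EllipticCurves.QuadraticTwistMultiplicativeReductionProofs
import Literature.NumberTheory.EllipticCurves.OggFormulaPotGoodOrdinaryTwoProofs
import HarnessLib

/-!
# Ogg's formula at `2` for the elliptic curves over `ℚ` with `j = 0`, and bsd.S15 for them

`Proofs` file (theorems only, no definitions, no named facts) in topic
`NumberTheory/EllipticCurves`, landed by the seat of bsd.S15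
(`Literature.NumberTheory.EllipticCurves.conductorNorm_eq_artinConductorNat`).  It assembles the
Galois side (`MordellCurveSwanConductorProofs`: `Sw_𝔓(V_ℓ E) = 2 · vol {u > 0 : Γ^u moves √k}` for
`y² = x³ + k`, at `2` equal to `0, 2, 4`) and the discriminant side
(`MordellCurveTateAlgorithmTwoProofs`: `δ₂ = 0, 2, 4` by Tate's algorithm) into **Saito's half of
Ogg's formula 11.1 at `p = 2` for every elliptic curve over `ℚ` with `j = 0`** — the first
sub-family of the one remaining leaf of Ogg–Saito over `ℚ` (additive, potentially good reduction
at `2` with `ord₂(j) > 0`, `OggFormulaPotGoodOrdinaryTwoProofs`) to be settled: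

* `exists_variableChange_mordell_int` — an elliptic `W/ℚ` with `c₄ = 0` is `ℚ`-isomorphic to
  `y² = x³ + k` with `k ∈ ℤ`, `64 ∤ k` (short Weierstrass form, `scaledShortNF_*`, scaled);
* `swanConductorAt_rationalTate_eq_wildConductorExponent_of_ringChar_eq_two_of_c₄_eq_zero`,
  `…_of_j_eq_zero` — the named fact
  `WeierstrassCurve.swanConductorAt_rationalTate_eq_wildConductorExponent_of_ringChar_eq_two W ℓ`
  (`HasseWeilAbelianConductorOggSaito`) for such `W` and every prime `ℓ` (both sides are invariant
  under the change of equation: `swanConductorAt_rationalTate_variableChange`,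
  `wildConductorExponent_smul'`);
* consequently, unconditionally and for every prime `ℓ`, for every elliptic curve over `ℚ` with
  `j = 0`: `artinConductorExponent_tate_eq_conductorExponent_of_isElliptic_of_c₄_eq_zero`
  (`a_p(V_ℓ E) = f_p(E)`), `conductorNatOf_geomPoints_eq_conductorNorm_of_isElliptic_of_c₄_eq_zero`
  (C15), `conductorNorm_eq_artinConductorNat_of_isElliptic_of_c₄_eq_zero`,
  `conductorNorm_eq_artinConductorNat_of_c₄_eq_zero` and
  `conductor_eq_conductorOf_mul_of_isElliptic_of_c₄_eq_zero` (bsd.S15, corrected, schema and ideal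
  forms).

E.g. `y² = x³ + 1` (`N = 36`, `f₂ = 2`), `y² = x³ - 1` (`144`, `f₂ = 4`), `y² = x³ + 2`
(`1728`, `f₂ = 6`).  What remains of Saito's theorem over `ℚ`: additive, potentially good
reduction at `2` with `ord₂(j) > 0` and `j ≠ 0`.

## References

* J. H. Silverman, *Advanced Topics in the Arithmetic of Elliptic Curves*, GTM 151 (1994), §IV.10
  (PDF p. 358), Thm. IV.11.1 (p. 365; p. 366 for `p = 2`), Table 4.1. [SilvermanATAEC1994]
* T. Saito, *Conductor, discriminant, and the Noether formula of arithmetic surfaces*, Duke Math.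
  J. 57 (1988), Thm. 1 (cited only). [Saito1988]
* J. H. Silverman, *The Arithmetic of Elliptic Curves*, 2nd ed. (2009), III.1, X.6.
  [SilvermanAEC2009]
-/

noncomputable section

open scoped Classical NumberField
open IsDedekindDomain Field Rat.HeightOneSpectrum Literature.NumberTheory.EllipticCurves
  Literature.NumberTheory.GaloisRepresentations Literature.NumberTheory.DiophantineGeometry

namespace WeierstrassCurve

variable (W : WeierstrassCurve ℚ)

/-! ### A `j = 0` curve over `ℚ` is `y² = x³ + k` with `k ∈ ℤ`, `64 ∤ k` -/

/-- **Integral Mordell model.**  An elliptic `W / ℚ` with `c₄ = 0` (i.e. `j = 0`) is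
`ℚ`-isomorphic to `y² = x³ + k` with `k ∈ ℤ`, `k ≠ 0`, `64 ∤ k`: the short Weierstrass model
`(u; 0,0,0) • shortNF(W)` has `a₄ = -u⁻⁴c₄/48 = 0`, `a₆ = -u⁻⁶c₆/864` (`scaledShortNF_*`), and `u`
may be chosen to make `a₆` an integer not divisible by `2⁶` (clear the denominator, then divide
`u` by a power of `2`).  Silverman *AEC* III.1 and X.6 (the curves `y² = x³ + D`).
[cite: SilvermanAEC2009, III.1 (short Weierstrass form) and X.6] -/
theorem exists_variableChange_mordell_int [W.IsElliptic] (hc₄ : W.c₄ = 0) :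
    ∃ (C : VariableChange ℚ) (k : ℤ), k ≠ 0 ∧ ¬ (64 : ℤ) ∣ k ∧
      (C • W).a₁ = 0 ∧ (C • W).a₂ = 0 ∧ (C • W).a₃ = 0 ∧ (C • W).a₄ = 0 ∧
      (C • W).a₆ = (k : ℚ) := by
  haveI : Invertible (2 : ℚ) := invertibleOfNonzero two_ne_zero
  haveI : Invertible (3 : ℚ) := invertibleOfNonzero three_ne_zero
  -- `c₆ ≠ 0`
  have hc₆ : W.c₆ ≠ 0 := by
    intro h
    have := W.c_relation
    rw [hc₄, h] at this
    have hΔ : W.Δ = 0 := by linear_combination this / 1728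
    exact W.isUnit_Δ.ne_zero hΔ
  set r : ℚ := -W.c₆ / 864 with hr
  have hr0 : r ≠ 0 := by
    rw [hr]; exact div_ne_zero (neg_ne_zero.mpr hc₆) (by norm_num)
  -- clear the denominator: `n = r · den⁶ = num · den⁵`
  set n : ℤ := r.num * r.den ^ 5 with hn
  have hn0 : n ≠ 0 := mul_ne_zero (Rat.num_ne_zero.mpr hr0) (pow_ne_zero _ (by exact_mod_cast r.den_nz))
  have hrn : r * (r.den : ℚ) ^ 6 = (n : ℚ) := by
    rw [hn, Int.cast_mul, Int.cast_pow, Int.cast_natCast, show (6 : ℕ) = 1 + 5 from rfl, pow_add,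
      pow_one, ← mul_assoc, Rat.mul_den_eq_num]
  -- strip the powers of `64`
  obtain ⟨e, m, hm64, hnm⟩ := Nat.exists_eq_pow_mul_and_not_dvd (Int.natAbs_ne_zero.mpr hn0) 64
    (by norm_num)
  have hm0 : m ≠ 0 := by
    rintro rfl; rw [mul_zero] at hnm; exact (Int.natAbs_ne_zero.mpr hn0) hnm
  set k : ℤ := n.sign * m with hk
  have hnk : n = k * 64 ^ e := by
    have h1 : (n.natAbs : ℤ) = 64 ^ e * m := by exact_mod_cast hnm
    calc n = n.sign * (n.natAbs : ℤ) := (Int.sign_mul_natAbs n).symm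
      _ = k * 64 ^ e := by rw [h1, hk]; ring
  have hk0 : k ≠ 0 := by
    rw [hk]
    exact mul_ne_zero (fun h => hn0 (Int.sign_eq_zero_iff_zero.mp h)) (by exact_mod_cast hm0)
  have hk64 : ¬ (64 : ℤ) ∣ k := by
    rw [hk]
    intro h
    apply hm64
    have h' := Int.natAbs_dvd_natAbs.mpr h
    rwa [Int.natAbs_mul, Int.natAbs_sign_of_ne_zero hn0, one_mul, Int.natAbs_natCast] at h'
  -- the scaling `u = 2^e / den`
  set u : ℚ := (2 : ℚ) ^ e / r.den with hu
  have hden : (r.den : ℚ) ≠ 0 := by exact_mod_cast r.den_nz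
  have hu0 : u ≠ 0 := div_ne_zero (pow_ne_zero _ two_ne_zero) hden
  have hru : r * u⁻¹ ^ 6 = (k : ℚ) := by
    have h64 : ((64 : ℤ) : ℚ) ^ e = ((2 : ℚ) ^ e) ^ 6 := by
      rw [← pow_mul, mul_comm, pow_mul]; norm_num
    have hnk' : (n : ℚ) = (k : ℚ) * ((2 : ℚ) ^ e) ^ 6 := by
      rw [← h64]; exact_mod_cast hnk
    rw [hu, inv_div, div_pow, mul_div_assoc', hrn, hnk']
    field_simp
  refine ⟨⟨Units.mk0 u hu0, 0, 0, 0⟩ * W.toShortNF, k, hk0, hk64, ?_, ?_, ?_, ?_, ?_⟩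
  · rw [mul_smul]; exact scaledShortNF_a₁ W hu0
  · rw [mul_smul]; exact scaledShortNF_a₂ W hu0
  · rw [mul_smul]; exact scaledShortNF_a₃ W hu0
  · rw [mul_smul, scaledShortNF_a₄ W hu0, hc₄]; simp
  · rw [mul_smul, scaledShortNF_a₆ W hu0, ← hru, hr]; ring

/-! ### Ogg's formula at `2` for `j = 0` -/

variable (ℓ : ℕ) [Fact ℓ.Prime]

/-- **Ogg's formula at `2`, wild part, for the elliptic curves over `ℚ` with `j = 0` (`c₄ = 0`)**
(Silverman *ATAEC* IV.11.1, the `j = 0` case of Saito's theorem at `p = 2`; unconditionally).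
The named fact `swanConductorAt_rationalTate_eq_wildConductorExponent_of_ringChar_eq_two W ℓ` holds
for every prime `ℓ`: at the place `v` above `2`, replace `W` by its integral Mordell model
`W' = C • W : y² = x³ + k`, `64 ∤ k` (`exists_variableChange_mordell_int`; both sides are invariant,
`swanConductorAt_rationalTate_variableChange`, `wildConductorExponent_smul'`); write `k = c²k₀`
with `k₀ ≡ 1, 3, 2 (mod 4)` according to the `2`-adic shape of `k`: then
`δ_v(W') = 0, 2, 4` by Tate's algorithm (`exists_sq_mul_wildConductorExponent_mordell`,
`MordellCurveTateAlgorithmTwoProofs`: types IV, IV* | II, I₀*, II* | II, I₀*, II*), while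
`Sw_𝔓(V_ℓ E) = 2 · vol {u > 0 : Γ^u moves √k₀} = 0, 2, 4`
(`MordellCurveSwanConductorProofs`: the `3`-torsion point `(0, √k)` and the break `0, 1, 2` of
`ℚ₂(√k₀)`).
[cite: SilvermanATAEC1994, Thm. IV.11.1 (PDF p. 365; p. 366 for p = 2) with §IV.10 Definition of δ (p. 358) and Table 4.1]
[cite: Saito1988, Theorem 1] [cite: SilvermanAEC2009, X.6 (the curves y² = x³ + D)] -/
theorem swanConductorAt_rationalTate_eq_wildConductorExponent_of_ringChar_eq_two_of_c₄_eq_zero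
    (hc₄ : W.c₄ = 0) :
    W.swanConductorAt_rationalTate_eq_wildConductorExponent_of_ringChar_eq_two ℓ := by
  intro hE h v hℓ hadd h2 𝔓 h𝔓
  -- the place `v` is the place above `2`
  have hv2 : (2 : 𝓞 ℚ) ∈ v.asIdeal := by
    have := v.natCast_ringChar_mem; rwa [h2, Nat.cast_ofNat] at this
  have hv : natGenerator v = 2 := Rat.natGenerator_eq_two hv2
  haveI := perfectField_residueField_adicCompletionIntegers (K := ℚ) v
  -- the integral Mordell model `W' = C • W`
  obtain ⟨C, k, hk0, hk64, e1, e2, e3, e4, e6⟩ := W.exists_variableChange_mordell_int hc₄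
  have hadd' : (C • W).HasAdditiveReductionAt v :=
    (hasAdditiveReductionAt_smul_iff_holds v W C).mpr hadd
  have h' := (C • W).continuous_rationalGaloisRepTate_holds ℓ
  rw [← wildConductorExponent_smul' v W C,
    ← W.swanConductorAt_rationalTate_variableChange C ℓ h h' hℓ h𝔓]
  -- discriminant side
  obtain ⟨c, hc, k₀, hkc, hcases⟩ :=
    exists_sq_mul_wildConductorExponent_mordell v hv (C • W) e1 e2 e3 e4 hk0 hk64 e6 hadd'
  have ha₆ : (C • W).a₆ = c ^ 2 * k₀ := by rw [e6, hkc]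
  -- Galois side
  rcases hcases with ⟨h1, hδ⟩ | ⟨h3, hδ⟩ | ⟨h2', hδ⟩
  · rw [(C • W).swanConductorAt_rationalTate_eq_zero_of_a₆_eq_sq_mul_of_emod_four_eq_one ℓ e1 e2 e3
      e4 hc h1 ha₆ h' hv2 hℓ h𝔓, hδ, Nat.cast_zero]
  · rw [(C • W).swanConductorAt_rationalTate_eq_two_of_a₆_eq_sq_mul_of_emod_four_eq_three ℓ e1 e2 e3
      e4 hc h3 ha₆ h' hv2 hℓ h𝔓, hδ, Nat.cast_ofNat]
  · rw [(C • W).swanConductorAt_rationalTate_eq_four_of_a₆_eq_sq_mul_of_emod_four_eq_two ℓ e1 e2 e3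
      e4 hc h2' ha₆ h' hv2 hℓ h𝔓, hδ, Nat.cast_ofNat]

/-- The same keyed on the `j`-invariant: **Ogg's formula at `2` for every elliptic curve over `ℚ`
with `j = 0`** (`j = c₄³/Δ`, so `j = 0` iff `c₄ = 0`).
[cite: SilvermanATAEC1994, Thm. IV.11.1 (PDF p. 365; p. 366 for p = 2)] [cite: Saito1988, Theorem 1] -/
theorem swanConductorAt_rationalTate_eq_wildConductorExponent_of_ringChar_eq_two_of_j_eq_zero
    (hj : ∀ [W.IsElliptic], W.j = 0) :
    W.swanConductorAt_rationalTate_eq_wildConductorExponent_of_ringChar_eq_two ℓ := by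
  intro hE
  have hc₄ : W.c₄ = 0 := by
    have h := hj
    rw [WeierstrassCurve.j, mul_eq_zero] at h
    rcases h with h | h
    · exact absurd h (Units.ne_zero _)
    · exact pow_eq_zero_iff three_ne_zero |>.mp h
  exact W.swanConductorAt_rationalTate_eq_wildConductorExponent_of_ringChar_eq_two_of_c₄_eq_zero ℓ hc₄

/-! ### Consequences: C15 and bsd.S15 for the `j = 0` curves over `ℚ`, unconditionally -/

/-- **`a_p(V_ℓ E) = f_p(E)` at every `p ≠ ℓ`, every `ℓ`, for every elliptic curve over `ℚ` with
`j = 0`** — unconditionally (through `artinConductorExponent_tate_eq_conductorExponent_of_isElliptic_of_two`).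
[cite: SilvermanATAEC1994, §IV.10 Definition of ε, δ, f and Thm. IV.10.2 (PDF p. 358), Thm. IV.11.1 (p. 365; p. 366 for p = 2)] -/
theorem artinConductorExponent_tate_eq_conductorExponent_of_isElliptic_of_c₄_eq_zero
    (hc₄ : W.c₄ = 0) : W.artinConductorExponent_tate_eq_conductorExponent_of_isElliptic ℓ :=
  W.artinConductorExponent_tate_eq_conductorExponent_of_isElliptic_of_two ℓ
    (W.swanConductorAt_rationalTate_eq_wildConductorExponent_of_ringChar_eq_two_of_c₄_eq_zero ℓ hc₄)

/-- **C15 `conductorNatOf (geomPoints W) ℓ h = N_E` for every `ℓ` and every elliptic curve over `ℚ`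
with `j = 0`** — unconditionally (through `conductorNatOf_geomPoints_eq_conductorNorm_of_isElliptic_of_two`).
[cite: SerreTate1968, §3]
[cite: SilvermanATAEC1994, §IV.10 Definition of the conductor (PDF p. 364), Thm. IV.11.1 (p. 365; p. 366 for p = 2)] -/
theorem conductorNatOf_geomPoints_eq_conductorNorm_of_isElliptic_of_c₄_eq_zero (hc₄ : W.c₄ = 0) :
    W.conductorNatOf_geomPoints_eq_conductorNorm_of_isElliptic ℓ :=
  W.conductorNatOf_geomPoints_eq_conductorNorm_of_isElliptic_of_two ℓ
    (W.swanConductorAt_rationalTate_eq_wildConductorExponent_of_ringChar_eq_two_of_c₄_eq_zero ℓ hc₄)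

/-! ### The remaining leaf: `ord₂(j) > 0` and `j ≠ 0` -/

attribute [local instance] AddSubgroup.torsionBy.zmodModule in
/-- **Saito's half of Ogg's formula at `2` over `ℚ`, every `ℓ`, from its case `ord₂(j) > 0`,
`j ≠ 0` in `3`-torsion form at one prime.**  Let `v₂` be the place of `𝓞 ℚ` above `2`.  Suppose
that *if `W` (elliptic) has additive reduction at `v₂`, `|j(W)|₂ < 1` and `j(W) ≠ 0`, then
`Sw_𝔓(E[3]) = δ₂(E)` for some prime `𝔓 ∣ v₂` of `\bar ℤ`*.  Then
`swanConductorAt_rationalTate_eq_wildConductorExponent_of_ringChar_eq_two W ℓ` holds for every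
prime `ℓ`: the case `j = 0` is `…_of_j_eq_zero` (read on `E[3]` at `ℓ = 3`), and the rest is
fed to `…_of_valuation_j_lt_one` (`OggFormulaPotGoodOrdinaryTwoProofs`).  After this theorem the
only input separating the tree from Ogg–Saito for all elliptic curves over `ℚ` is Ogg's formula
for the curves `E/ℚ₂` with **additive, potentially good reduction, `ord₂(j) > 0` and `j ≠ 0`**.
[cite: SilvermanATAEC1994, §IV.10 Definition of δ(E/K) (PDF p. 358), Thm. IV.11.1 case p = 2 (pp. 365–366)]
[cite: Saito1988, Theorem 1] -/
theorem swanConductorAt_rationalTate_eq_wildConductorExponent_of_ringChar_eq_two_of_valuation_j_lt_one_of_j_ne_zero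
    (H : ∀ [W.IsElliptic], W.HasAdditiveReductionAt
        ((Rat.HeightOneSpectrum.primesEquiv (R := 𝓞 ℚ)).symm ⟨2, Nat.prime_two⟩) →
      ((Rat.HeightOneSpectrum.primesEquiv (R := 𝓞 ℚ)).symm ⟨2, Nat.prime_two⟩).valuation ℚ W.j
          < 1 → W.j ≠ 0 →
      ∃ 𝔓 ∈ ((Rat.HeightOneSpectrum.primesEquiv (R := 𝓞 ℚ)).symm ⟨2, Nat.prime_two⟩).primesAbove,
        (W.torsionGaloisRep 3).swanConductorAt (𝓞 ℚ) 𝔓 =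
          (W.wildConductorExponent
            ((Rat.HeightOneSpectrum.primesEquiv (R := 𝓞 ℚ)).symm ⟨2, Nat.prime_two⟩) : ℝ)) :
    W.swanConductorAt_rationalTate_eq_wildConductorExponent_of_ringChar_eq_two ℓ := by
  haveI : Fact (Nat.Prime 3) := ⟨Nat.prime_three⟩
  set v₂ : HeightOneSpectrum (𝓞 ℚ) :=
    (Rat.HeightOneSpectrum.primesEquiv (R := 𝓞 ℚ)).symm ⟨2, Nat.prime_two⟩ with hv₂def
  have hv₂ : (2 : 𝓞 ℚ) ∈ v₂.asIdeal := by
    have := (natCast_mem_asIdeal_iff_eq_primesEquiv_symm v₂ Nat.prime_two).mpr rfl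
    exact_mod_cast this
  have h3v : ((3 : ℕ) : 𝓞 ℚ) ∉ v₂.asIdeal := three_notMem_of_two_mem hv₂
  apply W.swanConductorAt_rationalTate_eq_wildConductorExponent_of_ringChar_eq_two_of_valuation_j_lt_one ℓ
  intro hE hadd hlt
  by_cases hj : W.j = 0
  · -- `j = 0`: Ogg's formula at `ℓ = 3` for this curve, read on `E[3]` at any prime above `2`
    obtain ⟨𝔓, h𝔓⟩ := v₂.primesAbove_nonempty
    have h3 := W.swanConductorAt_rationalTate_eq_wildConductorExponent_of_ringChar_eq_two_of_j_eq_zero 3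
      (fun {_} ↦ hj)
    have hc : ringChar (𝓞 ℚ ⧸ v₂.asIdeal) = 2 := by
      by_contra hne
      exact v₂.natCast_notMem_of_ringChar_ne Nat.prime_two hne (by exact_mod_cast hv₂)
    refine ⟨𝔓, h𝔓, ?_⟩
    rw [← W.swanConductorAt_rationalTate_eq_swanConductorAt_torsion 3
      (W.continuous_rationalGaloisRepTate_holds 3) h3v h𝔓]
    exact h3 (W.continuous_rationalGaloisRepTate_holds 3) v₂ h3v hadd hc h𝔓
  · exact H hadd hlt hj

attribute [local instance] AddSubgroup.torsionBy.zmodModule in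
/-- **C15 for every `ℓ` from Ogg's formula at `2` for the additive curves over `ℚ` with `ord₂(j) > 0`,
`j ≠ 0` alone** (through `conductorNatOf_geomPoints_eq_conductorNorm_of_isElliptic_of_two`); the
shape of the eventual discharge `conductorNatOf_geomPoints_eq_conductorNorm_of_isElliptic_holds`.
[cite: SerreTate1968, §3]
[cite: SilvermanATAEC1994, §IV.10 Definition of the conductor (PDF p. 364), Thm. IV.11.1 (p. 365; p. 366 for p = 2)]
[cite: Saito1988, Theorem 1] -/
theorem conductorNatOf_geomPoints_eq_conductorNorm_of_isElliptic_of_valuation_j_lt_one_of_j_ne_zero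
    (H : ∀ [W.IsElliptic], W.HasAdditiveReductionAt
        ((Rat.HeightOneSpectrum.primesEquiv (R := 𝓞 ℚ)).symm ⟨2, Nat.prime_two⟩) →
      ((Rat.HeightOneSpectrum.primesEquiv (R := 𝓞 ℚ)).symm ⟨2, Nat.prime_two⟩).valuation ℚ W.j
          < 1 → W.j ≠ 0 →
      ∃ 𝔓 ∈ ((Rat.HeightOneSpectrum.primesEquiv (R := 𝓞 ℚ)).symm ⟨2, Nat.prime_two⟩).primesAbove,
        (W.torsionGaloisRep 3).swanConductorAt (𝓞 ℚ) 𝔓 =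
          (W.wildConductorExponent
            ((Rat.HeightOneSpectrum.primesEquiv (R := 𝓞 ℚ)).symm ⟨2, Nat.prime_two⟩) : ℝ)) :
    W.conductorNatOf_geomPoints_eq_conductorNorm_of_isElliptic ℓ :=
  W.conductorNatOf_geomPoints_eq_conductorNorm_of_isElliptic_of_two ℓ
    (W.swanConductorAt_rationalTate_eq_wildConductorExponent_of_ringChar_eq_two_of_valuation_j_lt_one_of_j_ne_zero
      ℓ H)

end WeierstrassCurve

namespace Literature.NumberTheory.EllipticCurves

open _root_.WeierstrassCurve

variable (W : WeierstrassCurve ℚ) (ℓ : ℕ) [Fact ℓ.Prime]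

/-- **bsd.S15, corrected form `N_E = N^{(ℓ)}(V_ℓ E)`, for every prime `ℓ` and every elliptic curve
over `ℚ` with `j = 0` (`c₄ = 0`)** — unconditionally (`conductorNorm_eq_artinConductorNat_of_isElliptic_of_two_three`,
`HasseWeilAbelianConductorSwanIndependenceTwoProofs`, with Ogg's formula at `2` for `j = 0` at `ℓ = 3`).
[cite: SilvermanATAEC1994, §IV.10 Definition (PDF p. 364), Thm. IV.10.2 (p. 358), Thm. IV.11.1 (pp. 365–371)] -/
theorem conductorNorm_eq_artinConductorNat_of_isElliptic_of_c₄_eq_zero (hc₄ : W.c₄ = 0) :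
    conductorNorm_eq_artinConductorNat_of_isElliptic W ℓ :=
  haveI : Fact (Nat.Prime 3) := ⟨Nat.prime_three⟩
  conductorNorm_eq_artinConductorNat_of_isElliptic_of_two_three W ℓ
    (W.swanConductorAt_rationalTate_eq_wildConductorExponent_of_ringChar_eq_two_of_c₄_eq_zero 3 hc₄)

/-- **The seat's schema `conductorNorm_eq_artinConductorNat W ℓ` at an elliptic `W/ℚ` with
`j = 0`, every `ℓ`.**
[cite: SilvermanATAEC1994, §IV.10 Definition (PDF p. 364), Thm. IV.10.2 (p. 358), Thm. IV.11.1 (pp. 365–371)] -/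
theorem conductorNorm_eq_artinConductorNat_of_c₄_eq_zero [W.IsElliptic] (hc₄ : W.c₄ = 0) :
    conductorNorm_eq_artinConductorNat W ℓ :=
  haveI : Fact (Nat.Prime 3) := ⟨Nat.prime_three⟩
  conductorNorm_eq_artinConductorNat_of_two_three W ℓ
    (W.swanConductorAt_rationalTate_eq_wildConductorExponent_of_ringChar_eq_two_of_c₄_eq_zero 3 hc₄)

/-- **bsd.S15 (d), corrected ideal form `𝔣(E/ℚ) = 𝔣^{(ℓ)}(V_ℓ E) · (ℓ)^{f_ℓ}`, for every prime `ℓ`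
and every elliptic curve over `ℚ` with `j = 0`.**
[cite: SilvermanATAEC1994, §IV.10 Definition (PDF p. 364), Thm. IV.10.2 (p. 358), Thm. IV.11.1 (pp. 365–371)] -/
theorem conductor_eq_conductorOf_mul_of_isElliptic_of_c₄_eq_zero (hc₄ : W.c₄ = 0) :
    conductor_eq_conductorOf_mul_of_isElliptic W ℓ :=
  haveI : Fact (Nat.Prime 3) := ⟨Nat.prime_three⟩
  conductor_eq_conductorOf_mul_of_isElliptic_of_two_three W ℓ
    (W.swanConductorAt_rationalTate_eq_wildConductorExponent_of_ringChar_eq_two_of_c₄_eq_zero 3 hc₄)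

attribute [local instance] AddSubgroup.torsionBy.zmodModule in
/-- **bsd.S15, corrected numerical form `N_E = N^{(ℓ)}(V_ℓ E)`, for every prime `ℓ`, from Ogg's
formula at `2` for the additive curves over `ℚ` with `ord₂(j) > 0`, `j ≠ 0` alone**; the shape
of the eventual discharge `conductorNorm_eq_artinConductorNat_of_isElliptic_holds`.
[cite: SerreTate1968, §3]
[cite: SilvermanATAEC1994, §IV.10 Definition of the conductor (PDF p. 364), Thm. IV.10.2 (p. 358), Thm. IV.11.1 (p. 365; p. 366 for p = 2)]
[cite: Saito1988, Theorem 1] -/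
theorem conductorNorm_eq_artinConductorNat_of_isElliptic_of_valuation_j_lt_one_of_j_ne_zero
    (H : ∀ [W.IsElliptic], W.HasAdditiveReductionAt
        ((Rat.HeightOneSpectrum.primesEquiv (R := 𝓞 ℚ)).symm ⟨2, Nat.prime_two⟩) →
      ((Rat.HeightOneSpectrum.primesEquiv (R := 𝓞 ℚ)).symm ⟨2, Nat.prime_two⟩).valuation ℚ W.j
          < 1 → W.j ≠ 0 →
      ∃ 𝔓 ∈ ((Rat.HeightOneSpectrum.primesEquiv (R := 𝓞 ℚ)).symm ⟨2, Nat.prime_two⟩).primesAbove,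
        (W.torsionGaloisRep 3).swanConductorAt (𝓞 ℚ) 𝔓 =
          (W.wildConductorExponent
            ((Rat.HeightOneSpectrum.primesEquiv (R := 𝓞 ℚ)).symm ⟨2, Nat.prime_two⟩) : ℝ)) :
    conductorNorm_eq_artinConductorNat_of_isElliptic W ℓ :=
  (W.conductorNatOf_geomPoints_eq_conductorNorm_of_isElliptic_iff_conductorNorm_eq_artinConductorNat_of_isElliptic
      ℓ).mp
    (W.conductorNatOf_geomPoints_eq_conductorNorm_of_isElliptic_of_valuation_j_lt_one_of_j_ne_zero ℓ H)

attribute [local instance] AddSubgroup.torsionBy.zmodModule in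
/-- **bsd.S15 (d), corrected ideal form, for every prime `ℓ`, from Ogg's formula at `2` for the
additive curves over `ℚ` with `ord₂(j) > 0`, `j ≠ 0` alone** (through
`conductor_eq_conductorOf_mul_of_isElliptic_of_two_three` at `ℓ = 3` and every `ℓ`).
[cite: SilvermanATAEC1994, §IV.10 Definition of the conductor (PDF p. 364), Thm. IV.11.1 (p. 365; p. 366 for p = 2)]
[cite: Saito1988, Theorem 1] -/
theorem conductor_eq_conductorOf_mul_of_isElliptic_of_valuation_j_lt_one_of_j_ne_zero
    (H : ∀ [W.IsElliptic], W.HasAdditiveReductionAt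
        ((Rat.HeightOneSpectrum.primesEquiv (R := 𝓞 ℚ)).symm ⟨2, Nat.prime_two⟩) →
      ((Rat.HeightOneSpectrum.primesEquiv (R := 𝓞 ℚ)).symm ⟨2, Nat.prime_two⟩).valuation ℚ W.j
          < 1 → W.j ≠ 0 →
      ∃ 𝔓 ∈ ((Rat.HeightOneSpectrum.primesEquiv (R := 𝓞 ℚ)).symm ⟨2, Nat.prime_two⟩).primesAbove,
        (W.torsionGaloisRep 3).swanConductorAt (𝓞 ℚ) 𝔓 =
          (W.wildConductorExponent
            ((Rat.HeightOneSpectrum.primesEquiv (R := 𝓞 ℚ)).symm ⟨2, Nat.prime_two⟩) : ℝ)) :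
    conductor_eq_conductorOf_mul_of_isElliptic W ℓ :=
  haveI : Fact (Nat.Prime 3) := ⟨Nat.prime_three⟩
  conductor_eq_conductorOf_mul_of_isElliptic_of_two_three W ℓ
    (W.swanConductorAt_rationalTate_eq_wildConductorExponent_of_ringChar_eq_two_of_valuation_j_lt_one_of_j_ne_zero
      3 H)

end Literature.NumberTheory.EllipticCurves

end
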